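import Mathlib

/-!
# [OURS · L1 W4.5a · F-108 toric infrastructure 1/7] Decorated unimodular cones, barycentric star subdivisions, the invariant bundle

Support file toward the OURS open-obligation node `F108ClassRow.F108Consumable` (✓ p680734, chain w45a, crux `FInjectiveMacaulayfication`
stmt-ResolutionOfSingularities-15315): the kernel construction of a unimodular projective refinement of the Newton fan of a convenient
polynomial «in the consumer's fan-table currency» (seat res-L1-toric-fan g0; scoping memo `L/res-L1-w45a-stub-1/g13-F108-SCOPING.md`).
AI-written; weaker than expert review. Nothing here proves resolution of singularities in positive characteristic.

This first file fixes the bookkeeping (no geometry is asserted, everything is finitary over `ℤ`):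

* `DCone n` — a DECORATED CONE: `n` slot-indexed rays `ray i ∈ ℤⁿ` (rows of the chart matrix), the vertex `m ∈ ℤⁿ` of the support
  function on the cone, the integral dual basis `w i` (`ray j ⬝ᵥ w i = δᵢⱼ`) and the index `l` of the cone of the fan of `Bl₀ 𝔸ⁿ` it refines;
* `bary τ = Σ τ`, `child`, `scaleD`, `dstar N S τ` — the barycentric star subdivision of a finite set of decorated cones at the face with ray set
  `τ`, with the support-function recursion `m' = N·m + w i₀` (new exceptional divisor with coefficient `1/N` relative to the old polarisation)
  and the dual-basis update; `mem_dstar`;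
* `Good 𝒜 d` — the rays of `d` have a common minimiser in the finite exponent set `𝒜` (the support function of `𝒜` is linear on the cone);
* `Inv S` — the invariant bundle carried along the construction (nonnegativity, coordinate-or-interior rays, dual basis, `l`-minimality,
  boundary vanishing and positivity of the vertices, STRICT CONCAVITY `sc`, 𝔪-DOMINATION `dom`, NEIGHBOUR MEMBERSHIP `amem`, COMPLETENESS);
* first consequences: injectivity and non-vanishing of the rays, `bary` as a slot sum, `bary ⬝ᵥ w`, unimodularity of the ray matrix, every
  coordinate vector is a ray of some cone, `0 ≤ ray ⬝ᵥ (m' − m)`.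

Sources for the underlying toric facts (not used as facts, only as a guide): Cox–Little–Schenck, *Toric Varieties* (2011), §11.1
(star subdivisions, Thm. 11.1.9) and §6.1–§7.1 (support functions, ampleness); Fulton (1993) §2.6.
-/

set_option linter.dupNamespace false

noncomputable section

namespace Summit.ResolutionOfSingularities.ResolutionOfSingularities.Theorems.FInjectiveMacaulayfication.F108Toric

open Matrix Finset

variable {n : ℕ}

/-! ## Decorated cones and the star subdivision -/

/-- A DECORATED CONE of the construction: slot-indexed rays (rows of the chart matrix), the vertex `m` of the support function on the
cone, the integral dual basis `w` of the rays, and the index `l` of the ancestor cone of the fan of the blow-up of the origin. [OURS · bookkeeping] -/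
structure DCone (n : ℕ) where
  /-- the rays, one per slot -/
  ray : Fin n → Fin n → ℤ
  /-- the vertex: the linear function representing the support function on this cone -/
  m : Fin n → ℤ
  /-- the dual basis: `ray j ⬝ᵥ w i = δᵢⱼ` -/
  w : Fin n → Fin n → ℤ
  /-- the coordinate minimal on the cone (`ray i l ≤ ray i j`) -/
  l : Fin n
  deriving DecidableEq

/-- The set of rays of a decorated cone. [OURS · bookkeeping] -/
def DCone.rays (d : DCone n) : Finset (Fin n → ℤ) := univ.image d.ray

/-- The barycentre `Σ_{ρ ∈ τ} ρ` of a face given by its ray set. [OURS · bookkeeping] -/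
def bary (τ : Finset (Fin n → ℤ)) : Fin n → ℤ := ∑ ρ ∈ τ, ρ

open Classical in
/-- The child of an affected cone `d` replacing the ray in slot `i₀` by the barycentre of `τ`: support-function recursion `m' = N·m + w i₀`
(the tent function of the new ray has linear piece `w i₀` on this child) and the dual basis of the new rays. [OURS · bookkeeping] -/
def child (N : ℤ) (τ : Finset (Fin n → ℤ)) (d : DCone n) (i₀ : Fin n) : DCone n where
  ray := Function.update d.ray i₀ (bary τ)
  m := N • d.m + d.w i₀
  w := fun i => if d.ray i ∈ τ ∧ i ≠ i₀ then d.w i - d.w i₀ else d.w i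
  l := d.l

/-- An unaffected cone keeps its rays; its vertex is rescaled with the polarisation. [OURS · bookkeeping] -/
def scaleD (N : ℤ) (d : DCone n) : DCone n where
  ray := d.ray
  m := N • d.m
  w := d.w
  l := d.l

open Classical in
/-- The barycentric STAR SUBDIVISION at the face with ray set `τ` of a finite set of decorated cones, with polarisation scale `N`:
every cone containing `τ` is replaced by its children, every other cone is kept (rescaled). [OURS · bookkeeping; cf. Cox–Little–Schenck §11.1] -/
def dstar (N : ℤ) (S : Finset (DCone n)) (τ : Finset (Fin n → ℤ)) : Finset (DCone n) :=
  S.biUnion fun d => if τ ⊆ d.rays then (univ.filter fun i => d.ray i ∈ τ).image (child N τ d) else {scaleD N d}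

/-- Membership in a star subdivision. [OURS · bookkeeping] -/
theorem mem_dstar {N : ℤ} {S : Finset (DCone n)} {τ : Finset (Fin n → ℤ)} {d' : DCone n} :
    d' ∈ dstar N S τ ↔ ∃ d ∈ S, (τ ⊆ d.rays ∧ ∃ i, d.ray i ∈ τ ∧ d' = child N τ d i) ∨ (¬ τ ⊆ d.rays ∧ d' = scaleD N d) := by
  classical
  unfold dstar
  simp only [mem_biUnion]
  refine exists_congr fun d => and_congr_right fun _ => ?_
  split_ifs with h
  · simp only [mem_image, mem_filter, mem_univ, true_and, h, true_and, not_true_eq_false, false_and, or_false]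
    exact exists_congr fun i => by rw [eq_comm]
  · simp [h]

/-- The child keeps the index `l`. -/
@[simp] theorem child_l (N : ℤ) (τ : Finset (Fin n → ℤ)) (d : DCone n) (i₀ : Fin n) : (child N τ d i₀).l = d.l := rfl

/-- The vertex of a child: `N·m + w i₀`. -/
@[simp] theorem child_m (N : ℤ) (τ : Finset (Fin n → ℤ)) (d : DCone n) (i₀ : Fin n) : (child N τ d i₀).m = N • d.m + d.w i₀ := rfl

/-- The replaced slot of a child carries the barycentre. -/
theorem child_ray_self (N : ℤ) (τ : Finset (Fin n → ℤ)) (d : DCone n) (i₀ : Fin n) : (child N τ d i₀).ray i₀ = bary τ := by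
  simp [child]

/-- The other slots of a child keep their rays. -/
theorem child_ray_of_ne (N : ℤ) (τ : Finset (Fin n → ℤ)) (d : DCone n) {i₀ i : Fin n} (h : i ≠ i₀) :
    (child N τ d i₀).ray i = d.ray i := by
  simp [child, h]

/-- The dual basis of a child. -/
theorem child_w (N : ℤ) (τ : Finset (Fin n → ℤ)) (d : DCone n) (i₀ i : Fin n) :
    (child N τ d i₀).w i = if d.ray i ∈ τ ∧ i ≠ i₀ then d.w i - d.w i₀ else d.w i := by
  simp [child]

/-- Rescaling keeps the rays. -/
@[simp] theorem scaleD_ray (N : ℤ) (d : DCone n) : (scaleD N d).ray = d.ray := rfl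
/-- Rescaling multiplies the vertex by `N`. -/
@[simp] theorem scaleD_m (N : ℤ) (d : DCone n) : (scaleD N d).m = N • d.m := rfl
/-- Rescaling keeps the dual basis. -/
@[simp] theorem scaleD_w (N : ℤ) (d : DCone n) : (scaleD N d).w = d.w := rfl
/-- Rescaling keeps the index `l`. -/
@[simp] theorem scaleD_l (N : ℤ) (d : DCone n) : (scaleD N d).l = d.l := rfl
/-- Rescaling keeps the ray set. -/
@[simp] theorem scaleD_rays (N : ℤ) (d : DCone n) : (scaleD N d).rays = d.rays := rfl

/-- Membership in the ray set. -/
theorem mem_rays {d : DCone n} {ρ : Fin n → ℤ} : ρ ∈ d.rays ↔ ∃ i, d.ray i = ρ := by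
  simp [DCone.rays]

/-- Each slot ray belongs to the ray set. -/
theorem ray_mem_rays (d : DCone n) (i : Fin n) : d.ray i ∈ d.rays := mem_rays.2 ⟨i, rfl⟩

/-! ## Goodness and the invariant bundle -/

/-- `Good 𝒜 d`: the finite exponent set `𝒜` has a COMMON MINIMISER on the rays of `d`, i.e. the support function
`ρ ↦ min_{b ∈ 𝒜} ⟨ρ, b⟩` is linear on the cone. [OURS · bookkeeping] -/
def Good (𝒜 : Finset (Fin n → ℤ)) (d : DCone n) : Prop :=
  ∃ b ∈ 𝒜, ∀ i, ∀ b' ∈ 𝒜, d.ray i ⬝ᵥ b ≤ d.ray i ⬝ᵥ b'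

/-- THE INVARIANT BUNDLE of the construction (all finitary statements about a finite set of decorated cones):
nonnegative rays, each a coordinate vector or with all coordinates `≥ 1`; dual basis; `l`-minimality; the support function vanishes on rays
with a zero coordinate; `m ≥ 0`, `m_l ≥ 1`; STRICT CONCAVITY (`sc`: a ray of `d` is tight for the vertex of `d'` iff it is a ray of `d'`);
𝔪-DOMINATION (`dom`: the kink of the support function dominates the kink of `min_j w_j`); NEIGHBOUR MEMBERSHIP (`amem`: `m + w i` is in the
polyhedron of the 𝔪-quotient, or `w i` is an edge `e_{j'} − e_l` of the simplex); COMPLETENESS (every lattice point of the closed orthant is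
a nonnegative integral combination of the rays of some cone). [OURS · bookkeeping] -/
structure Inv (S : Finset (DCone n)) : Prop where
  /-- rays are nonnegative -/
  nonneg : ∀ d ∈ S, ∀ i j, 0 ≤ d.ray i j
  /-- every ray is a coordinate vector or interior -/
  stdOrPos : ∀ d ∈ S, ∀ i, (∃ j, d.ray i = Pi.single j 1) ∨ ∀ j, 1 ≤ d.ray i j
  /-- `w` is the dual basis of the rays -/
  dual : ∀ d ∈ S, ∀ i j, d.ray j ⬝ᵥ d.w i = if i = j then 1 else 0
  /-- the coordinate `l` is minimal on every ray -/
  lmin : ∀ d ∈ S, ∀ i j, d.ray i d.l ≤ d.ray i j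
  /-- the support function vanishes on rays with a zero coordinate -/
  bdry : ∀ d ∈ S, ∀ i, (∃ j, d.ray i j = 0) → d.ray i ⬝ᵥ d.m = 0
  /-- vertices are nonnegative -/
  mnonneg : ∀ d ∈ S, ∀ j, 0 ≤ d.m j
  /-- the `l`-coordinate of the vertex is positive -/
  mlpos : ∀ d ∈ S, 1 ≤ d.m d.l
  /-- strict concavity -/
  sc : ∀ d ∈ S, ∀ d' ∈ S, ∀ i, d.ray i ⬝ᵥ (d'.m - d.m) = 0 ↔ d.ray i ∈ d'.rays
  /-- 𝔪-domination (implies concavity) -/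
  dom : ∀ d ∈ S, ∀ d' ∈ S, ∀ i, d.ray i d'.l - d.ray i d.l ≤ d.ray i ⬝ᵥ (d'.m - d.m)
  /-- neighbour membership -/
  amem : ∀ d ∈ S, ∀ i, (∀ d'' ∈ S, ∀ j, d''.ray j d.l - d''.ray j d''.l ≤ d''.ray j ⬝ᵥ (d.m + d.w i - d''.m)) ∨
    ∃ j', d.w i = Pi.single j' 1 - Pi.single d.l 1
  /-- completeness -/
  complete : ∀ x : Fin n → ℤ, (∀ j, 0 ≤ x j) → ∃ d ∈ S, ∃ c : Fin n → ℤ, (∀ i, 0 ≤ c i) ∧ x = ∑ i, c i • d.ray i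

/-! ## First consequences -/

/-- Dot product of a finite sum of vectors. [folklore] -/
theorem sum_dotProduct' {ι : Type*} (s : Finset ι) (f : ι → Fin n → ℤ) (v : Fin n → ℤ) :
    (∑ x ∈ s, f x) ⬝ᵥ v = ∑ x ∈ s, f x ⬝ᵥ v := by
  classical
  induction s using Finset.induction_on with
  | empty => simp
  | insert a s ha ih => rw [sum_insert ha, sum_insert ha, add_dotProduct, ih]

/-- Dot product with a finite sum of vectors. [folklore] -/
theorem dotProduct_sum' {ι : Type*} (s : Finset ι) (f : ι → Fin n → ℤ) (v : Fin n → ℤ) :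
    v ⬝ᵥ (∑ x ∈ s, f x) = ∑ x ∈ s, v ⬝ᵥ f x := by
  rw [dotProduct_comm, sum_dotProduct']
  exact sum_congr rfl fun x _ => dotProduct_comm _ _

section consequences

variable {S : Finset (DCone n)} (hS : Inv S)
include hS

/-- The rays of a cone are pairwise distinct. -/
theorem Inv.ray_injective {d : DCone n} (hd : d ∈ S) : Function.Injective d.ray := by
  intro i j hij
  have h1 := hS.dual d hd i i
  have h2 := hS.dual d hd i j
  rw [← hij, h1] at h2
  by_contra hne
  simp [hne] at h2

/-- A ray pairs to `1` with its own dual vector, hence is non-zero. -/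
theorem Inv.ray_ne_zero {d : DCone n} (hd : d ∈ S) (i : Fin n) : d.ray i ≠ 0 := by
  intro h
  have h1 := hS.dual d hd i i
  simp [h] at h1

/-- For an affected cone the barycentre of `τ` is the sum of the rays in the slots carrying `τ`. -/
theorem Inv.bary_eq_sum {d : DCone n} (hd : d ∈ S) {τ : Finset (Fin n → ℤ)} (hτ : τ ⊆ d.rays) :
    bary τ = ∑ i ∈ univ.filter (fun i => d.ray i ∈ τ), d.ray i := by
  classical
  have hτeq : τ = (univ.filter fun i => d.ray i ∈ τ).image d.ray := by
    ext ρ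
    simp only [mem_image, mem_filter, mem_univ, true_and]
    constructor
    · intro hρ
      obtain ⟨i, rfl⟩ := mem_rays.1 (hτ hρ)
      exact ⟨i, hρ, rfl⟩
    · rintro ⟨i, hi, rfl⟩
      exact hi
  unfold bary
  rw [hτeq, sum_image]
  · rw [← hτeq]
  · intro i _ j _ h
    exact hS.ray_injective hd h

/-- The barycentre pairs with the dual vectors of an affected cone as the indicator of the slots carrying `τ`. -/
theorem Inv.bary_dotProduct_w {d : DCone n} (hd : d ∈ S) {τ : Finset (Fin n → ℤ)} (hτ : τ ⊆ d.rays) (i : Fin n) :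
    bary τ ⬝ᵥ d.w i = if d.ray i ∈ τ then 1 else 0 := by
  classical
  rw [hS.bary_eq_sum hd hτ, sum_dotProduct']
  simp_rw [hS.dual d hd]
  rw [sum_ite_eq]
  simp

/-- The ray matrix times the transposed dual-basis matrix is the identity. -/
theorem Inv.ray_mul_w_transpose {d : DCone n} (hd : d ∈ S) :
    Matrix.of d.ray * (Matrix.of d.w)ᵀ = 1 := by
  ext j i
  rw [Matrix.mul_apply, Matrix.one_apply]
  have h := hS.dual d hd i j
  unfold dotProduct at h
  simp only [of_apply, transpose_apply]
  rw [h]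
  by_cases hij : i = j
  · simp [hij]
  · simp [hij, Ne.symm hij]

/-- The chart matrix of a cone of the construction is UNIMODULAR. -/
theorem Inv.isUnit_det {d : DCone n} (hd : d ∈ S) : IsUnit (Matrix.of d.ray).det := by
  have h := congrArg Matrix.det (hS.ray_mul_w_transpose hd)
  rw [det_mul, det_one] at h
  exact isUnit_of_dvd_one (Dvd.intro _ h)

/-- Concavity: a ray of `d` pairs nonnegatively with `m' − m` (from `dom` and `lmin`). -/
theorem Inv.sc_nonneg {d d' : DCone n} (hd : d ∈ S) (hd' : d' ∈ S) (i : Fin n) : 0 ≤ d.ray i ⬝ᵥ (d'.m - d.m) :=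
  le_trans (sub_nonneg.2 (hS.lmin d hd i d'.l)) (hS.dom d hd d' hd' i)

/-- Consistency of the support function: a ray of `d` that is also a ray of `d'` takes the same value on both vertices. -/
theorem Inv.dot_m_eq_of_mem {d d' : DCone n} (hd : d ∈ S) (hd' : d' ∈ S) {i : Fin n} (h : d.ray i ∈ d'.rays) :
    d.ray i ⬝ᵥ d'.m = d.ray i ⬝ᵥ d.m := by
  have h0 := (hS.sc d hd d' hd' i).2 h
  rwa [dotProduct_sub, sub_eq_zero] at h0

/-- Every coordinate vector `e_j` is a ray of some cone (completeness + nonnegativity). -/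
theorem Inv.exists_ray_eq_single (j : Fin n) : ∃ d ∈ S, ∃ i, d.ray i = Pi.single j 1 := by
  obtain ⟨d, hd, c, hc, hx⟩ := hS.complete (Pi.single j 1) (fun k => by
    by_cases h : k = j <;> simp [h])
  -- some coefficient is positive
  have hex : ∃ i, 0 < c i := by
    by_contra hno
    have h0 : ∀ i, c i = 0 := fun i => le_antisymm (not_lt.1 (not_exists.1 hno i)) (hc i)
    have := congrFun hx j
    simp [h0] at this
  obtain ⟨i, hi⟩ := hex
  refine ⟨d, hd, i, ?_⟩
  -- `c i • ray i ≤ e_j` componentwise forces `ray i = e_j`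
  have hle : ∀ k, c i * d.ray i k ≤ (Pi.single j 1 : Fin n → ℤ) k := by
    intro k
    have hk := congrFun hx k
    rw [Finset.sum_apply] at hk
    simp only [Pi.smul_apply, smul_eq_mul] at hk
    rw [hk]
    exact single_le_sum (f := fun i' => c i' * d.ray i' k) (fun i' _ => mul_nonneg (hc i') (hS.nonneg d hd i' k)) (mem_univ i)
  funext k
  by_cases hk : k = j
  · subst hk
    have h1 : d.ray i k ≤ 1 := by
      have := hle k
      simp only [Pi.single_eq_same] at this
      nlinarith [hS.nonneg d hd i k]
    -- `ray i ≠ 0` and all other coordinates vanish, so this coordinate is `1`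
    have hzero : ∀ k', k' ≠ k → d.ray i k' = 0 := by
      intro k' hk'
      have := hle k'
      simp only [Pi.single_apply, hk', if_false] at this
      nlinarith [hS.nonneg d hd i k']
    rcases (hS.nonneg d hd i k).lt_or_eq with hpos | hz
    · simp only [Pi.single_eq_same]; omega
    · exfalso
      apply hS.ray_ne_zero hd i
      funext k'
      by_cases hk' : k' = k
      · subst hk'; exact hz.symm
      · exact hzero k' hk'
  · have := hle k
    simp only [Pi.single_apply, hk, if_false] at this
    have h0 : d.ray i k = 0 := by nlinarith [hS.nonneg d hd i k]
    simp [hk, h0]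

end consequences

end Summit.ResolutionOfSingularities.ResolutionOfSingularities.Theorems.FInjectiveMacaulayfication.F108Toric

end
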